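import Summits.RiemannHypothesis.RiemannHypothesis.Theorems.LaguerreSpeiserSplitDipInJensenDisc
import Literature.NumberTheory.DiophantineGeometry.NamedHypotheses
import Literature.NumberTheory.LFunctions.ZetaRealAxis
import HarnessLib

/-!
# The Laguerre sign of `Ξ` at real critical points below the verified height (rung of C′, RH-free given Platt–Trudgian)

Route `LaguerreSpeiserSplit`, `--supports` crux C′ = `LaguerreSignAtCriticalPoints`
(stmt-RiemannHypothesis-23196).  CONDITIONAL on the named numerical fact
`Literature.NumberTheory.DiophantineGeometry.riemannHypothesisUpTo_platt_trudgian` (RH verified for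
`0 < Im s ≤ 3 000 175 332 800`, Platt–Trudgian, Bull. LMS 53 (2021) Thm 1), taken as a hypothesis.
Nothing here bears on the truth of RH; RH is NOT proved by this file, and C′ itself (all heights) stays open.

**Theorem `laguerreSignBelowVerifiedHeight`.**  Assume RH up to height `H = 3000175332800`.  Then at
every real critical point `c` of `t ↦ Re Ξ(t)` with `Ξ(c) ≠ 0` and `|c| < H − ½`, the Laguerre sign is
the right one: `Ξ(c) · Ξ″(c) < 0` ("every Lehmer dip below the verified height crosses the axis").
This is Csordas–Ruttan–Varga 1991, Prop. 2.2-type reasoning lifted to the Platt–Trudgian height.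

**Proof (15 lines on top of the engine `Theorems.dipInJensenDisc`, stmt-RiemannHypothesis-23303).**  A
wrong-sign dip at `c` lies in the closed Jensen disc of a non-real zero `ρ` of `Ξ`:
`|c − Re ρ| ≤ |Im ρ| < ½`.  Under RH up to height `H`, every zero `ρ` of `Ξ` with `|Re ρ| ≤ H` is real
(`im_eq_zero_of_riemannXiUpper_eq_zero_of_abs_re_le`: the `ζ`-zero is `s = ½ + iρ`, `Im s = Re ρ`;
`Re ρ < 0` is reduced to `Re ρ > 0` by the evenness of `Ξ`, and `Re ρ = 0` would make `s` a real zero of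
`ζ` in `(0, 1)`, excluded by `riemannZeta_ofReal_ne_zero_of_pos_of_lt_one`).  Hence `|Re ρ| > H`, while
`|Re ρ| ≤ |c| + |c − Re ρ| < (H − ½) + ½ = H` — contradiction.
-/

-- `Summit.RiemannHypothesis.RiemannHypothesis.…` repeats a component by the tree's layout (D-0017).
set_option linter.dupNamespace false

noncomputable section

namespace Summit.RiemannHypothesis.RiemannHypothesis.Theorems.LaguerreSignBelowVerifiedHeight

open Complex
open Literature.NumberTheory.LFunctions Literature.NumberTheory.DiophantineGeometry

/-- **Under RH up to height `T`, the zeros of `Ξ` with `|Re ρ| ≤ T` are real.**  For a zero `ρ` of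
`Ξ(z) = ξ(½ + iz)` the `ζ`-zero `s = ½ + iρ` has `Re s = ½ − Im ρ ∈ (0, 1)` and `Im s = Re ρ`:
if `0 < Re ρ ≤ T` the hypothesis gives `Re s = ½`; `Re ρ < 0` reduces to this by `Ξ(−z) = Ξ(z)`;
`Re ρ = 0` is impossible since `ζ(σ) ≠ 0` for real `0 < σ < 1`. -/
theorem im_eq_zero_of_riemannXiUpper_eq_zero_of_abs_re_le {T : ℝ} (hT : RiemannHypothesisUpTo T)
    {ρ : ℂ} (hρ : riemannXiUpper ρ = 0) (hre : |ρ.re| ≤ T) : ρ.im = 0 := by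
  -- the case `Re ρ > 0`
  have key : ∀ w : ℂ, riemannXiUpper w = 0 → 0 < w.re → w.re ≤ T → w.im = 0 := by
    intro w hw hpos hle
    have h := (riemannXi_eq_zero_iff_holds (1 / 2 + I * w)).1 hw
    have hsre : (1 / 2 + I * w).re = 1 / 2 - w.im := by simp; ring
    have hsim : (1 / 2 + I * w).im = w.re := by simp
    have h12 := hT (1 / 2 + I * w) h.1 (by rw [hsim]; exact hpos) (by rw [hsim]; exact hle)
    rw [hsre] at h12
    linarith
  rcases lt_trichotomy ρ.re 0 with hneg | hzero | hpos
  · -- `Re ρ < 0`: apply `key` to `−ρ`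
    have h1 : riemannXiUpper (-ρ) = 0 := by rw [riemannXiUpper_neg]; exact hρ
    have h2 := key (-ρ) h1 (by simp; linarith) (by
      have : |ρ.re| = -ρ.re := abs_of_neg hneg
      simp; linarith)
    simpa using h2
  · -- `Re ρ = 0`: `s = ½ − Im ρ` would be a real zero of `ζ` in `(0, 1)`
    exfalso
    have h := (riemannXi_eq_zero_iff_holds (1 / 2 + I * ρ)).1 hρ
    have hsre : (1 / 2 + I * ρ).re = 1 / 2 - ρ.im := by simp; ring
    have hs : (1 / 2 + I * ρ) = (((1 / 2 - ρ.im : ℝ)) : ℂ) := by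
      apply Complex.ext
      · rw [hsre]; simp
      · simp [hzero]
    rw [hsre] at h
    rw [hs] at h
    exact riemannZeta_ofReal_ne_zero_of_pos_of_lt_one (1 / 2 - ρ.im) h.2.1 h.2.2 h.1
  · exact key ρ hρ hpos ((le_abs_self _).trans hre)

end LaguerreSignBelowVerifiedHeight

open Literature.NumberTheory.LFunctions in
/-- **The Laguerre sign at real critical points of `Ξ` below the verified height** (rung of crux C′ =
`LaguerreSignAtCriticalPoints`, stmt-RiemannHypothesis-23196; CONDITIONAL on the named fact
`riemannHypothesisUpTo_platt_trudgian` = RH verified up to height `3 000 175 332 800`, Platt–Trudgian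
2021 Thm 1).  For every real `c` with `|c| < 3000175332800 − ½` which is a critical point of
`t ↦ Re Ξ(t)` with `Ξ(c) ≠ 0`: `Re Ξ(c) · (Re Ξ)″(c) < 0`.  (Engine: `Theorems.dipInJensenDisc` — a
wrong-sign dip lies within horizontal distance `< ½` of an off-line zero, and there is none with
`|Re ρ| ≤ 3000175332800` under the hypothesis.)  RH is not proved by this; nothing here bears on the
truth of RH. -/
theorem laguerreSignBelowVerifiedHeight
    (hPT : Literature.NumberTheory.DiophantineGeometry.riemannHypothesisUpTo_platt_trudgian) :
    ∀ c : ℝ, |c| < 3000175332800 - 1 / 2 →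
      deriv (fun u : ℝ => (Literature.NumberTheory.LFunctions.riemannXiUpper (u : ℂ)).re) c = 0 →
      (Literature.NumberTheory.LFunctions.riemannXiUpper (c : ℂ)).re ≠ 0 →
      (Literature.NumberTheory.LFunctions.riemannXiUpper (c : ℂ)).re *
        iteratedDeriv 2 (fun u : ℝ => (Literature.NumberTheory.LFunctions.riemannXiUpper (u : ℂ)).re) c < 0 := by
  intro c hcT hc1 hc0
  by_contra hge
  push Not at hge
  obtain ⟨ρ, hρ0, hρim, hdisc⟩ := dipInJensenDisc c hc1 hc0 hge
  have him : |ρ.im| < 1 / 2 := abs_im_lt_half_of_riemannXiUpper_eq_zero hρ0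
  have hfar : ¬ |ρ.re| ≤ 3000175332800 := fun hle ↦
    hρim (LaguerreSignBelowVerifiedHeight.im_eq_zero_of_riemannXiUpper_eq_zero_of_abs_re_le hPT hρ0 hle)
  have htri : |ρ.re| ≤ |c| + |c - ρ.re| := by
    have := abs_sub_abs_le_abs_sub ρ.re c
    rw [abs_sub_comm ρ.re c] at this
    linarith
  exact hfar (by linarith)

end Summit.RiemannHypothesis.RiemannHypothesis.Theorems

end
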